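import Summits.AtomisticToContinuum.Crystallization.Theorems.ChartedZeroExcessLayeredLatticeLiouvilleZZD

/-!
# Part ZZE «ConePins — metric half» (lens-2 g80; (B′.1) of the REACH DESIGN at the inner zone boundary, critic row 1440 (A)(2)(ii))

The (T)-endgame must certify sheet compatibility (`LinChartConcl` clause (c)) for EVERY zone atom down to depth `d(·, K) − r = 0⁺`, while
certified link maps live only on the deep window (`N²` partnered, depth `> 3·17/16`).  The g80 design (memo `g80/memo/Bprime-reach.md`)
replaces «free steps» by a DOWNWARD INDUCTION on `Φ := dist(·, x₀)` over the shallow zone sites, each step a «CONE PIN»: the two-shell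
sites of `x` lying ROBUSTLY in the outward `60°`-cone are zone atoms (ZZD/ZZDA `lt_dist_of_cone`) with LARGER `Φ`, hence already pinned;
they constrain the partner index of `x` up to finitely many straight competitors, themselves in the cone, excluded by injectivity of the
partner map.  This rider supplies the METRIC half of that step, in any real inner-product space where possible:

* §1 SHARP PERTURBATION: `‖b − u‖ ≤ s` gives `⟪b, u⟫ ≥ (‖b‖² + ‖u‖² − s²)/2` (`inner_ge_of_norm_sub_le`) and, by AM–GM, `⟪b, u⟫ ≥ c‖b‖`
  for every `c ≥ 0` with `c² + s² ≤ ‖u‖²` (`mul_norm_le_inner_of_near`) — the wobble `a/16` costs `arcsin(1/16) ≈ 3.6°`, not `2·3.6°`.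
* §2 TWO ANGLES (spherical triangle inequality `InnerProductGeometry.angle_le_angle_add_angle`, as in ZZDA §1): `cos ∠(b,u) ≥ c₁`,
  `cos ∠(u,w) ≥ c₂` (`cᵢ ≥ 0`, `cᵢ² + sᵢ² ≥ 1`) give `⟪b, w⟫ ≥ (c₁c₂ − s₁s₂)‖b‖‖w‖` (`inner_ge_of_two_angles`); with §1,
  `inner_ge_of_near_of_toward`.  ★ MEMBER LEMMAS with rational constants (no square roots): an atom within `a/16` of `p + U` is in the
  physical `60°`-cone of `w` (`½‖n − p‖‖w‖ ≤ ⟪n − p, w⟫`) when `‖U‖ = a` and `⟪U, w⟫ ≥ (5/9)‖U‖‖w‖` (FIRST SHELL, pattern angle `≤ 56.25°`: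
  `member_cone_first`; `0.998·5/9 − 0.0633·0.8316 = 0.5018 ≥ ½`) or `‖U‖² = 2a²` and `⟪U, w⟫ ≥ (11/20)‖U‖‖w‖` (SECOND SHELL, `≤ 56.6°`:
  `member_cone_second`; `0.999·11/20 − 0.0448·0.8352 = 0.5120 ≥ ½`).  These are the thresholds of the numerically certified pin table
  (memo §4: all 8 letter contexts, ≥ 3 members, ≤ 1 competitor).
* §3 `Φ`-GAIN: a step in the `60°`-cone of `p − x₀` gains radius `dist n x₀ ≥ dist p x₀ + ½‖n − p‖` (`dist_add_half_le_of_cone`).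
* §4 ★ DETERMINISTIC ZONE MEMBERSHIP `mem_moatIn_of_cone` (symbolic dials `2q ≤ r`, container `K ⊆ B̄(x₀, q)`, ANY step length `L` with
  `ρ + L + q < ℓ`): a GIVEN atom `n ∈ S` in the `60°`-cone at a zone atom `p` is a zone atom with `Φ`-gain — the form the pin induction consumes
  (ZZD's `exists_zone_neighbour_of_container` only produced SOME neighbour); record instance `mem_moatIn_record_of_cone` at
  `(q, r, ℓ) = (4, 8, 43/2)`, shallow radius `ρ ≤ 76/5`, reach `L ≤ 43/20` (memo §5: shallow sites have `Φ ≤ 8 + 51/16 + 4 < 76/5`, pins reach `≤ 2.13`).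
* §5 the DOWNWARD INDUCTION PRINCIPLE on a finite site set by decreasing `Φ` (`pin_induction`).

0 sorry; standard axioms.  Next riders of the design: (B′.2) FOUR-relation transfer, (B′.3) pin tables by `decide`, (B′.4) LEMMA Θ, (B′.5) assembly.
-/

noncomputable section
open scoped BigOperators Classical InnerProductSpace RealInnerProductSpace
open MeasureTheory Set Metric Filter Topology
open Summit.AtomisticToContinuum.Crystallization.Theorems.ChartedPlanarOrderRigidityDoor (E3 IsClean IsCharted)

namespace Summit.AtomisticToContinuum.Crystallization.Theorems.ChartedZeroExcessLayeredLatticeLiouville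

section Metric

variable {V : Type*} [NormedAddCommGroup V] [InnerProductSpace ℝ V]

open InnerProductGeometry

/-! ### §1  Sharp perturbation of an inner product -/

/-- `‖b − u‖ ≤ s` gives `⟪b, u⟫ ≥ (‖b‖² + ‖u‖² − s²)/2` (expand `‖b − u‖²`). [this file, g80] -/
theorem inner_ge_of_norm_sub_le {b u : V} {s : ℝ} (h : ‖b - u‖ ≤ s) :
    (‖b‖ ^ 2 + ‖u‖ ^ 2 - s ^ 2) / 2 ≤ ⟪b, u⟫_ℝ := by
  have h1 : ‖b - u‖ ^ 2 ≤ s ^ 2 := pow_le_pow_left₀ (norm_nonneg _) h 2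
  rw [norm_sub_sq_real] at h1
  linarith

/-- ★ **SHARP WOBBLE BOUND**: `‖b − u‖ ≤ s` and `c² + s² ≤ ‖u‖²` (any real `c`) give `c‖b‖ ≤ ⟪b, u⟫` (AM–GM on §1:
`(‖b‖² + c²)/2 ≥ c‖b‖`); i.e. `cos ∠(b, u) ≥ √(1 − (s/‖u‖)²)` — the wobble costs `arcsin (s/‖u‖)`. [this file, g80] -/
theorem mul_norm_le_inner_of_near {b u : V} {s c : ℝ} (h : ‖b - u‖ ≤ s) (hcs : c ^ 2 + s ^ 2 ≤ ‖u‖ ^ 2) :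
    c * ‖b‖ ≤ ⟪b, u⟫_ℝ := by
  have h1 := inner_ge_of_norm_sub_le h
  nlinarith [sq_nonneg (‖b‖ - c)]

/-! ### §2  Two angles: the spherical triangle inequality with lower cosine bounds -/

/-- a vector whose angle to `u` has nonnegative cosine lower bound makes an angle `≤ π/2`. [this file, g80] -/
theorem angle_le_pi_div_two_of_cos_nonneg {x y : V} (h : 0 ≤ Real.cos (angle x y)) : angle x y ≤ Real.pi / 2 := by
  by_contra h'
  have := Real.cos_neg_of_pi_div_two_lt_of_lt (lt_of_not_ge h') (by linarith [angle_le_pi x y, Real.pi_pos])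
  linarith

/-- ★ **TWO ANGLES.**  `⟪b, u⟫ ≥ c₁‖b‖‖u‖`, `⟪u, w⟫ ≥ c₂‖u‖‖w‖` with `cᵢ ≥ 0`, `sᵢ ≥ 0`, `cᵢ² + sᵢ² ≥ 1`, `u ≠ 0` give
`⟪b, w⟫ ≥ (c₁c₂ − s₁s₂)‖b‖‖w‖`: `∠(b,w) ≤ ∠(b,u) + ∠(u,w) ≤ π` (`InnerProductGeometry.angle_le_angle_add_angle`) and
`cos (α + β) = cos α cos β − sin α sin β`. [this file, g80] -/
theorem inner_ge_of_two_angles {b u w : V} {c₁ c₂ s₁ s₂ : ℝ} (hc₁ : 0 ≤ c₁) (hc₂ : 0 ≤ c₂) (hs₁ : 0 ≤ s₁) (hs₂ : 0 ≤ s₂)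
    (hcs₁ : 1 ≤ c₁ ^ 2 + s₁ ^ 2) (hcs₂ : 1 ≤ c₂ ^ 2 + s₂ ^ 2) (hu : u ≠ 0)
    (hbu : c₁ * (‖b‖ * ‖u‖) ≤ ⟪b, u⟫_ℝ) (huw : c₂ * (‖u‖ * ‖w‖) ≤ ⟪u, w⟫_ℝ) :
    (c₁ * c₂ - s₁ * s₂) * (‖b‖ * ‖w‖) ≤ ⟪b, w⟫_ℝ := by
  by_cases hb0 : b = 0
  · rw [hb0, inner_zero_left, norm_zero, zero_mul, mul_zero]
  by_cases hw0 : w = 0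
  · rw [hw0, inner_zero_right, norm_zero, mul_zero, mul_zero]
  have hbpos : 0 < ‖b‖ := norm_pos_iff.2 hb0
  have hupos : 0 < ‖u‖ := norm_pos_iff.2 hu
  have hwpos : 0 < ‖w‖ := norm_pos_iff.2 hw0
  have hcosα : c₁ ≤ Real.cos (angle b u) := by
    rw [cos_angle, le_div_iff₀ (mul_pos hbpos hupos)]; exact hbu
  have hcosβ : c₂ ≤ Real.cos (angle u w) := by
    rw [cos_angle, le_div_iff₀ (mul_pos hupos hwpos)]; exact huw
  have hcα2 : c₁ ^ 2 ≤ Real.cos (angle b u) ^ 2 := pow_le_pow_left₀ hc₁ hcosα 2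
  have hcβ2 : c₂ ^ 2 ≤ Real.cos (angle u w) ^ 2 := pow_le_pow_left₀ hc₂ hcosβ 2
  have hsα0 : 0 ≤ Real.sin (angle b u) := sin_angle_nonneg b u
  have hsβ0 : 0 ≤ Real.sin (angle u w) := sin_angle_nonneg u w
  have hsinα : Real.sin (angle b u) ≤ s₁ := by
    nlinarith [Real.sin_sq_add_cos_sq (angle b u), mul_nonneg hsα0 hs₁]
  have hsinβ : Real.sin (angle u w) ≤ s₂ := by
    nlinarith [Real.sin_sq_add_cos_sq (angle u w), mul_nonneg hsβ0 hs₂]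
  have hαle : angle b u ≤ Real.pi / 2 := angle_le_pi_div_two_of_cos_nonneg (hc₁.trans hcosα)
  have hβle : angle u w ≤ Real.pi / 2 := angle_le_pi_div_two_of_cos_nonneg (hc₂.trans hcosβ)
  have htri : angle b w ≤ angle b u + angle u w := angle_le_angle_add_angle b u w
  have hcos1 : Real.cos (angle b u + angle u w) ≤ Real.cos (angle b w) :=
    Real.cos_le_cos_of_nonneg_of_le_pi (angle_nonneg b w) (by linarith) htri
  have hcos2 : c₁ * c₂ - s₁ * s₂ ≤ Real.cos (angle b u + angle u w) := by
    rw [Real.cos_add]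
    have h1 : c₁ * c₂ ≤ Real.cos (angle b u) * Real.cos (angle u w) := mul_le_mul hcosα hcosβ hc₂ (hc₁.trans hcosα)
    have h2 : Real.sin (angle b u) * Real.sin (angle u w) ≤ s₁ * s₂ := mul_le_mul hsinα hsinβ hsβ0 hs₁
    linarith
  rw [← cos_angle_mul_norm_mul_norm b w]
  exact mul_le_mul_of_nonneg_right (hcos2.trans hcos1) (by positivity)

/-- ★ **NEAR A VECTOR THAT POINTS TOWARD `w`.**  `‖b − U‖ ≤ s`, `U ≠ 0`, constants with `c₁²‖U‖² + s² ≤ ‖U‖²`, `cᵢ, sᵢ ≥ 0`,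
`cᵢ² + sᵢ² ≥ 1` and `⟪U, w⟫ ≥ c₂‖U‖‖w‖` give `⟪b, w⟫ ≥ (c₁c₂ − s₁s₂)‖b‖‖w‖` (§1 with `c = c₁‖U‖`, then §2). [this file, g80] -/
theorem inner_ge_of_near_of_toward {b U w : V} {s c₁ s₁ c₂ s₂ : ℝ} (hU : U ≠ 0) (hb : ‖b - U‖ ≤ s) (hc₁ : 0 ≤ c₁) (hc₂ : 0 ≤ c₂)
    (hs₁ : 0 ≤ s₁) (hs₂ : 0 ≤ s₂) (h1 : c₁ ^ 2 * ‖U‖ ^ 2 + s ^ 2 ≤ ‖U‖ ^ 2) (hcs₁ : 1 ≤ c₁ ^ 2 + s₁ ^ 2)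
    (hcs₂ : 1 ≤ c₂ ^ 2 + s₂ ^ 2) (hw : c₂ * (‖U‖ * ‖w‖) ≤ ⟪U, w⟫_ℝ) :
    (c₁ * c₂ - s₁ * s₂) * (‖b‖ * ‖w‖) ≤ ⟪b, w⟫_ℝ := by
  have hbu : c₁ * ‖U‖ * ‖b‖ ≤ ⟪b, U⟫_ℝ := mul_norm_le_inner_of_near (c := c₁ * ‖U‖) hb (by rw [mul_pow]; exact h1)
  exact inner_ge_of_two_angles hc₁ hc₂ hs₁ hs₂ hcs₁ hcs₂ hU (by linarith [hbu]) hw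

/-- ★★ **FIRST-SHELL MEMBER**: an atom `n` within `a/16` of `p + U`, `‖U‖ = a > 0`, with `⟪U, w⟫ ≥ (5/9)‖U‖‖w‖` (pattern angle
`≤ arccos (5/9) ≈ 56.25°`) lies in the physical `60°`-cone of `w`: `½‖n − p‖‖w‖ ≤ ⟪n − p, w⟫`.  Constants `c₁ = 0.998`, `s₁ = 0.0633`,
`c₂ = 5/9`, `s₂ = 0.8316`: `c₁c₂ − s₁s₂ = 0.5018… ≥ ½` (true margin `(5√255 − √56)/144 − ½ = 0.0025`, i.e. `0.16°`). [this file, g80] -/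
theorem member_cone_first {p n U w : V} {a : ℝ} (ha : 0 < a) (hU : ‖U‖ = a) (hn : dist n (p + U) ≤ 1 / 16 * a)
    (hw : 5 / 9 * (‖U‖ * ‖w‖) ≤ ⟪U, w⟫_ℝ) : 1 / 2 * (‖n - p‖ * ‖w‖) ≤ ⟪n - p, w⟫_ℝ := by
  have hU0 : U ≠ 0 := by rw [← norm_pos_iff, hU]; exact ha
  have hb : ‖(n - p) - U‖ ≤ 1 / 16 * a := by rw [sub_sub, ← dist_eq_norm]; exact hn
  have h := inner_ge_of_near_of_toward (c₁ := 998 / 1000) (s₁ := 633 / 10000) (c₂ := 5 / 9) (s₂ := 8316 / 10000) hU0 hb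
    (by norm_num) (by norm_num) (by norm_num) (by norm_num) (by rw [hU]; nlinarith [sq_nonneg a]) (by norm_num) (by norm_num) hw
  have h0 : 0 ≤ ‖n - p‖ * ‖w‖ := by positivity
  linarith [mul_le_mul_of_nonneg_right (show (1 : ℝ) / 2 ≤ 998 / 1000 * (5 / 9) - 633 / 10000 * (8316 / 10000) by norm_num) h0]

/-- ★★ **SECOND-SHELL MEMBER**: the same with `‖U‖² = 2a²` (second-shell site at `√2·a`) and threshold `⟪U, w⟫ ≥ (11/20)‖U‖‖w‖`
(pattern angle `≤ arccos (11/20) ≈ 56.6°`).  Constants `c₁ = 0.999`, `s₁ = 0.0448`, `c₂ = 11/20`, `s₂ = 0.8352`: `c₁c₂ − s₁s₂ = 0.5120 ≥ ½`.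
[this file, g80] -/
theorem member_cone_second {p n U w : V} {a : ℝ} (ha : 0 < a) (hU : ‖U‖ ^ 2 = 2 * a ^ 2) (hn : dist n (p + U) ≤ 1 / 16 * a)
    (hw : 11 / 20 * (‖U‖ * ‖w‖) ≤ ⟪U, w⟫_ℝ) : 1 / 2 * (‖n - p‖ * ‖w‖) ≤ ⟪n - p, w⟫_ℝ := by
  have hU0 : U ≠ 0 := by
    rw [← norm_pos_iff]; nlinarith [norm_nonneg U, sq_nonneg a, ha]
  have hb : ‖(n - p) - U‖ ≤ 1 / 16 * a := by rw [sub_sub, ← dist_eq_norm]; exact hn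
  have h := inner_ge_of_near_of_toward (c₁ := 999 / 1000) (s₁ := 448 / 10000) (c₂ := 11 / 20) (s₂ := 8352 / 10000) hU0 hb
    (by norm_num) (by norm_num) (by norm_num) (by norm_num) (by rw [hU]; nlinarith [sq_nonneg a]) (by norm_num) (by norm_num) hw
  have h0 : 0 ≤ ‖n - p‖ * ‖w‖ := by positivity
  linarith [mul_le_mul_of_nonneg_right (show (1 : ℝ) / 2 ≤ 999 / 1000 * (11 / 20) - 448 / 10000 * (8352 / 10000) by norm_num) h0]

/-! ### §3  The `Φ`-gain of a cone step -/

/-- ★ **`Φ`-GAIN**: a step `n − p` in the `60°`-cone of `p − x₀` (`½‖n − p‖‖p − x₀‖ ≤ ⟪n − p, p − x₀⟫`) gains radius: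
`dist p x₀ + ½‖n − p‖ ≤ dist n x₀` (`‖n − x₀‖² ≥ (‖p − x₀‖ + ½‖n − p‖)²`). [this file, g80] -/
theorem dist_add_half_le_of_cone {p n x₀ : V} (h : 1 / 2 * (‖n - p‖ * ‖p - x₀‖) ≤ ⟪n - p, p - x₀⟫_ℝ) :
    dist p x₀ + 1 / 2 * ‖n - p‖ ≤ dist n x₀ := by
  have hsq : dist n x₀ ^ 2 = ‖n - p‖ ^ 2 + 2 * ⟪n - p, p - x₀⟫_ℝ + ‖p - x₀‖ ^ 2 := by
    rw [dist_eq_norm, show n - x₀ = (n - p) + (p - x₀) by abel, norm_add_sq_real]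
  rw [dist_eq_norm p x₀]
  have hlow : (‖p - x₀‖ + 1 / 2 * ‖n - p‖) ^ 2 ≤ dist n x₀ ^ 2 := by
    rw [hsq]; nlinarith [norm_nonneg (n - p), norm_nonneg (p - x₀), sq_nonneg ‖n - p‖]
  by_contra hlt
  have hlt' : dist n x₀ < ‖p - x₀‖ + 1 / 2 * ‖n - p‖ := lt_of_not_ge hlt
  have := mul_self_lt_mul_self dist_nonneg hlt'
  nlinarith

end Metric

/-! ### §4  ★ Deterministic zone membership of a cone step -/

/-- ★★ **A CONE STEP STAYS IN THE ZONE (symbolic dials).**  Container `K ⊆ B̄(x₀, q)`, `2q ≤ r`, `0 ≤ r`; `p ∈ moatIn S K r ℓ` with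
`dist p x₀ ≤ ρ`; a GIVEN atom `n ∈ S` in the `60°`-cone of `p − x₀` at `p` with `0 < dist n p ≤ L` and `ρ + L + q < ℓ`.  Then
`n ∈ moatIn S K r ℓ` (far side: ZZDA `lt_dist_of_cone`; near side: triangle inequality), with the `Φ`-gain
`dist p x₀ + ½·dist n p ≤ dist n x₀ ≤ ρ + L` — so `n` precedes `p` in the downward-`Φ` induction. [this file, g80] -/
theorem mem_moatIn_of_cone {q r ℓ ρ L : ℝ} (hqr : 2 * q ≤ r) (hr : 0 ≤ r) {S K : Set E3} {x₀ p n : E3}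
    (hK : ∀ k ∈ K, dist k x₀ ≤ q) (hp : p ∈ moatIn S K r ℓ) (hn : n ∈ S)
    (hcone : 1 / 2 * (‖n - p‖ * ‖p - x₀‖) ≤ ⟪n - p, p - x₀⟫_ℝ) (hL : dist n p ≤ L) (hpx : dist p x₀ ≤ ρ) (hℓ : ρ + L + q < ℓ) :
    n ∈ moatIn S K r ℓ ∧ dist p x₀ + 1 / 2 * dist n p ≤ dist n x₀ ∧ dist n x₀ ≤ ρ + L := by
  obtain ⟨-, ⟨y₀, hy₀K, -⟩, hfar⟩ := hp
  have hcone' : ⟪n - p, x₀ - p⟫_ℝ ≤ -(1 / 2) * (‖n - p‖ * ‖x₀ - p‖) := by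
    rw [show x₀ - p = -(p - x₀) by abel, inner_neg_right, norm_neg]; linarith
  have hnx : dist n x₀ ≤ ρ + L :=
    calc dist n x₀ ≤ dist n p + dist p x₀ := dist_triangle _ _ _
      _ ≤ L + ρ := add_le_add hL hpx
      _ = ρ + L := add_comm _ _
  refine ⟨⟨hn, ⟨y₀, hy₀K, ?_⟩, fun y hyK => ?_⟩, ?_, hnx⟩
  · calc dist n y₀ ≤ dist n x₀ + dist x₀ y₀ := dist_triangle _ _ _
      _ ≤ (ρ + L) + q := add_le_add hnx (by rw [dist_comm]; exact hK y₀ hy₀K)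
      _ < ℓ := hℓ
  · exact lt_dist_of_cone hqr hr (hK y hyK) (by rw [dist_comm]; exact hfar y hyK) hcone'
  · rw [dist_eq_norm n p]; exact dist_add_half_le_of_cone hcone

/-- ★ **RECORD INSTANCE** `(q, r, ℓ) = (4, 8, 43/2)`, shallow radius `ρ = 76/5` (every shallow site has `Φ ≤ 8 + 51/16 + 4 = 243/16 < 76/5`),
pin reach `L = 43/20 ≥ 2a + a/8` (`a ≤ 1`): `76/5 + 43/20 + 4 = 427/20 < 43/2` ✓.  The landing radius `≤ 347/20 = 17.35` is `< 19.3`, inside the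
deep window's outer edge (memo §5). [this file, g80] -/
theorem mem_moatIn_record_of_cone {S K : Set E3} {x₀ p n : E3} (hK : ∀ k ∈ K, dist k x₀ ≤ 4) (hp : p ∈ moatIn S K 8 (43 / 2))
    (hn : n ∈ S) (hcone : 1 / 2 * (‖n - p‖ * ‖p - x₀‖) ≤ ⟪n - p, p - x₀⟫_ℝ) (hL : dist n p ≤ 43 / 20) (hpx : dist p x₀ ≤ 76 / 5) :
    n ∈ moatIn S K 8 (43 / 2) ∧ dist p x₀ + 1 / 2 * dist n p ≤ dist n x₀ ∧ dist n x₀ ≤ 347 / 20 := by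
  obtain ⟨h1, h2, h3⟩ := mem_moatIn_of_cone (q := 4) (r := 8) (ρ := 76 / 5) (L := 43 / 20) (ℓ := 43 / 2)
    (by norm_num) (by norm_num) hK hp hn hcone hL hpx (by norm_num)
  exact ⟨h1, h2, h3.trans (by norm_num)⟩

/-- the record numerology of the memo (§5) as one checked line: shallow bound `8 + 51/16 + 4 < 76/5`, reach `2 + 1/8 ≤ 43/20`,
closure `76/5 + 43/20 + 4 < 43/2`, landing `347/20 < 193/10` (deep-window outer edge `43/2 − 2·(17/16) − 1/20`). [this file, g80] -/
theorem conePin_record_numerology :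
    (8 : ℝ) + 51 / 16 + 4 < 76 / 5 ∧ (2 : ℝ) + 1 / 8 ≤ 43 / 20 ∧ (76 : ℝ) / 5 + 43 / 20 + 4 < 43 / 2 ∧
      (347 : ℝ) / 20 < 193 / 10 ∧ (193 : ℝ) / 10 ≤ 43 / 2 - 2 * (17 / 16) - 1 / 20 := by
  refine ⟨by norm_num, by norm_num, by norm_num, by norm_num, by norm_num⟩

/-! ### §5  The downward-`Φ` induction principle -/

/-- ★ **PIN INDUCTION**: on a finite site set `T`, if every `x ∈ T` is good as soon as all `y ∈ T` with LARGER potential `Φ y > Φ x` are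
good, then every site of `T` is good (strong induction on the number of sites above). In the design: `T` = shallow zone sites, `Φ = dist(Ψ·, x₀)`,
good = «partner index equals `Θ`»; deep sites are good by the window law and enter through the step hypothesis. [this file, g80] -/
theorem pin_induction {ι : Type*} (T : Finset ι) (Φ : ι → ℝ) {Good : ι → Prop}
    (step : ∀ x ∈ T, (∀ y ∈ T, Φ x < Φ y → Good y) → Good x) : ∀ x ∈ T, Good x := by
  classical
  suffices h : ∀ n : ℕ, ∀ x ∈ T, (T.filter (fun y => Φ x < Φ y)).card = n → Good x from
    fun x hx => h _ x hx rfl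
  intro n
  induction n using Nat.strong_induction_on with
  | _ n ih =>
    intro x hx hcard
    refine step x hx (fun y hy hxy => ih _ ?_ y hy rfl)
    rw [← hcard]
    apply Finset.card_lt_card
    refine ⟨fun z hz => ?_, fun hsub => ?_⟩
    · rw [Finset.mem_filter] at hz ⊢
      exact ⟨hz.1, hxy.trans hz.2⟩
    · have hy' : y ∈ T.filter (fun z => Φ x < Φ z) := Finset.mem_filter.2 ⟨hy, hxy⟩
      have h' := hsub hy'
      rw [Finset.mem_filter] at h'
      exact lt_irrefl _ h'.2

end Summit.AtomisticToContinuum.Crystallization.Theorems.ChartedZeroExcessLayeredLatticeLiouville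

end
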